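import Mathlib
import HarnessLib
import Summits.MatrixMultiplication.MatrixMultiplication.Theses.OutsiderSandwich
import Summits.MatrixMultiplication.MatrixMultiplication.Theorems.OutsiderSandwichLaserFloorTop
import Summits.MatrixMultiplication.MatrixMultiplication.Theorems.OutsiderSandwichLaserClassBlocks

/-!
# OutsiderSandwich — the LASER CLASS is decided, I-b: the capacity theorem
(decomp-mm lens 4 «minimal counterexample / extremal reduction», gen 12; continues
`OutsiderSandwichLaserClassBlocks.lean` — block values `F⟨2^a,2^b,2^c⟩ ≤ 2^{a+b+c−3k}2^{kτ_F}`,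
counting `C(N,min t)·F(block_t) ≤ 3^N 2^{((τ_F−2)/3)N}`, additivity over `matMulDirectSum`)

* §3 `F(D) ≤ (N+1)³·3^N·2^{((τ_F−2)/3)N}` for every universal spectral point `F` and every laser
  datum `D = ⊕ᵢ ⟨2^{xᵢ},2^{yᵢ},2^{zᵢ}⟩` of extent `N` (`xᵢ+yᵢ+zᵢ = N`, at most `C(N, min t)` blocks of
  each type `t`) — `map_laserDatum_le` (fibre sum over the `≤ (N+1)³` types).
* §4 CAPACITY: `B·m^{τ_F} ≤ F(⟨B⟩⊗⟨m,m,m⟩) ≤ F(D)`, so every packing `⟨B⟩ ⊗ ⟨m,m,m⟩ ≤ D` through a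
  laser datum obeys `B·m^{τ_F} ≤ (N+1)³·3^N·2^{((τ_F−2)/3)N}` at EVERY universal point
  (`laserClassCapacity_point`) and, at a top point `τ_G = ω` (g11 `exists_top_point`),
  `B·m^ω ≤ (N+1)³·3^N·2^{((ω−2)/3)N}` — the route item `LaserClassCapacity`
  (stmt-MatrixMultiplication-33773; `laserClassCapacity`, `laserClassCapacity_holds`).
  Per tensor factor the ω-capacity of the class is `3·2^{(ω−2)/3}` = the g11 laser FLOOR value
  `F(cw₂) ≥ 3·2^{(τ_F−2)/3}` (33322): on the laser class every spectral point sits ON its floor.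

Part II (`OutsiderSandwichLaserClassRates.lean`) turns the capacity into the rates: BOTTOM's
conclusion `m² ≤ 2^{(ℓ(ω)+ε)N}` for every single product through the class (`LaserClassMergeOptimal`,
33774), `LT(s)` through the class ⟹ `ω ≤ 2/s` (`LaserClassTangencyForcesOmega`, 33775), and
attainment by Coppersmith–Winograd's own construction (`LaserClassAttained`, 33776).  Upshot for the
cut: a counterexample to BOTTOM, and every LT-witness at `s > 2/ω`, is EXOTIC — it does not factor
through any laser datum (coupled or coarse blocks, or a degeneration `cw₂^{⊠N} ⊵ ⟨m,m,m⟩` with no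
block-diagonal intermediate) — by theorem.

Sources: CoppersmithWinograd1990 (§§6–7); BurgisserClausenShokrollahi1997 (Thm. 15.41, §15.7–15.8);
Strassen1988; Strassen1991 (asymptotic spectrum, support functionals); ChristandlVranaZuiddam2023
(§2); Blaser2013 (§§5–7); AmbainisFilmusLeGall2015 and AlmanVassilevskaWilliams2018 (limits of the
laser method on `CW_q` — the informal precedent of a class-restricted optimality statement; here the
class bound is a kernel theorem at the true `ω`).
-/

set_option linter.dupNamespace false

namespace Summit.MatrixMultiplication.MatrixMultiplication.Theorems.OutsiderSandwichLaserClass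

open scoped BigOperators
open Finset Filter
open Literature.Computability.AlgebraicComplexity
open Literature.Barriers.MatrixMultiplication (IsAdequate)
open Summit.MatrixMultiplication.MatrixMultiplication.Theorems.OutsiderSandwichLaserFloor
  (isAdequate_of_universal map_matMulTensor_one one_le_map_matMulTensor
    rpow_matExp_le_map_matMulTensor two_le_matExp)
open Summit.MatrixMultiplication.MatrixMultiplication.Theorems.OutsiderSandwichLaserFloorTop
  (exists_top_point)

open Summit.MatrixMultiplication.MatrixMultiplication.Theorems.OutsiderSandwichLaserClassBlocks
variable {F : SpectralMap ℂ}

/-! ## 3. The laser-datum bound `F(D) ≤ (N+1)³ · 3^N · 2^{((τ_F−2)/3)·N}` -/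

/-- **A universal point on a laser datum.**  For a LASER DATUM of extent `N` — `p` fine blocks
`⟨2^{x i}, 2^{y i}, 2^{z i}⟩` with `x i + y i + z i = N` and at most `C(N, min t)` blocks of each
type `t` — every universal spectral point satisfies
`F(⊕ᵢ ⟨2^{x i},2^{y i},2^{z i}⟩) ≤ (N+1)³ · 3^N · 2^{((τ_F − 2)/3)·N}`
(additivity `F(⊕) ≤ Σ`, the per-type bound, at most `(N+1)³` types). -/
theorem map_laserDatum_le (hF : IsUniversalSpectralPoint ℂ F) {N p : ℕ} {x y z : Fin p → ℕ}
    (hsum : ∀ i, x i + y i + z i = N)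
    (hcap : ∀ t : ℕ × ℕ × ℕ, (univ.filter (fun j => (x j, y j, z j) = t)).card ≤
      N.choose (min t.1 (min t.2.1 t.2.2))) :
    F (matMulDirectSum ℂ (fun i => 2 ^ x i) (fun i => 2 ^ y i) (fun i => 2 ^ z i)) ≤
      ((N : ℝ) + 1) ^ 3 * (3 : ℝ) ^ N *
        (2 : ℝ) ^ ((Real.logb 2 (F (matMulTensor ℂ 2 2 2)) - 2) / 3 * N) := by
  obtain ⟨M, hM⟩ : ∃ M : ℝ,
      M = (3 : ℝ) ^ N * (2 : ℝ) ^ ((Real.logb 2 (F (matMulTensor ℂ 2 2 2)) - 2) / 3 * N) :=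
    ⟨_, rfl⟩
  have hM0 : 0 ≤ M := by rw [hM]; positivity
  have himg : ∀ t ∈ univ.image (fun j => (x j, y j, z j)), t.1 + t.2.1 + t.2.2 = N := by
    intro t ht
    obtain ⟨i, -, rfl⟩ := mem_image.1 ht
    exact hsum i
  have hterm : ∀ t ∈ univ.image (fun j => (x j, y j, z j)),
      (univ.filter (fun j => (x j, y j, z j) = t)).card •
          F (matMulTensor ℂ (2 ^ t.1) (2 ^ t.2.1) (2 ^ t.2.2)) ≤ M := by
    intro t ht
    rw [nsmul_eq_mul, hM]
    calc ((univ.filter (fun j => (x j, y j, z j) = t)).card : ℝ) *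
          F (matMulTensor ℂ (2 ^ t.1) (2 ^ t.2.1) (2 ^ t.2.2))
        ≤ (N.choose (min t.1 (min t.2.1 t.2.2)) : ℝ) *
            F (matMulTensor ℂ (2 ^ t.1) (2 ^ t.2.1) (2 ^ t.2.2)) :=
          mul_le_mul_of_nonneg_right (by exact_mod_cast hcap t) (hF.nonneg _)
      _ ≤ _ := type_bound hF (himg t ht)
  have hcardT : ((univ.image (fun j => (x j, y j, z j))).card : ℝ) ≤ ((N : ℝ) + 1) ^ 3 := by
    have hsub : univ.image (fun j => (x j, y j, z j)) ⊆
        (range (N + 1)) ×ˢ ((range (N + 1)) ×ˢ (range (N + 1))) := by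
      intro t ht
      obtain ⟨i, -, rfl⟩ := mem_image.1 ht
      have := hsum i
      simp only [mem_product, mem_range]
      omega
    have h3 : (univ.image (fun j => (x j, y j, z j))).card ≤ (N + 1) ^ 3 := by
      refine (card_le_card hsub).trans ?_
      simp only [card_product, card_range]
      exact le_of_eq (by ring)
    exact_mod_cast h3
  calc F (matMulDirectSum ℂ (fun i => 2 ^ x i) (fun i => 2 ^ y i) (fun i => 2 ^ z i))
      ≤ ∑ i, F (matMulTensor ℂ (2 ^ x i) (2 ^ y i) (2 ^ z i)) :=
        (map_matMulDirectSum_eq_sum hF _ _ _).le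
    _ = ∑ t ∈ univ.image (fun j => (x j, y j, z j)),
          (univ.filter (fun j => (x j, y j, z j) = t)).card •
            F (matMulTensor ℂ (2 ^ t.1) (2 ^ t.2.1) (2 ^ t.2.2)) :=
        Finset.sum_comp (fun t : ℕ × ℕ × ℕ => F (matMulTensor ℂ (2 ^ t.1) (2 ^ t.2.1) (2 ^ t.2.2)))
          (fun j => (x j, y j, z j))
    _ ≤ (univ.image (fun j => (x j, y j, z j))).card • M := sum_le_card_nsmul _ _ _ hterm
    _ = ((univ.image (fun j => (x j, y j, z j))).card : ℝ) * M := nsmul_eq_mul _ _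
    _ ≤ ((N : ℝ) + 1) ^ 3 * M := mul_le_mul_of_nonneg_right hcardT hM0
    _ = _ := by rw [hM, mul_assoc]

/-! ## 4. Capacity of the laser class -/

/-- **Lower side**: `B · m^{τ_F} ≤ F(⟨B⟩ ⊗ ⟨m,m,m⟩)`. -/
theorem mul_rpow_matExp_le (hF : IsUniversalSpectralPoint ℂ F) (B m : ℕ) :
    (B : ℝ) * (m : ℝ) ^ Real.logb 2 (F (matMulTensor ℂ 2 2 2)) ≤
      F (kroneckerTensor (unitTensor ℂ B) (matMulTensor ℂ m m m)) := by
  rw [hF.map_kronecker, hF.map_unitTensor]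
  rcases Nat.eq_zero_or_pos m with rfl | hm
  · have hτ : Real.logb 2 (F (matMulTensor ℂ 2 2 2)) ≠ 0 :=
      (lt_of_lt_of_le two_pos (two_le_matExp hF)).ne'
    rw [Nat.cast_zero, Real.zero_rpow hτ, mul_zero]
    exact mul_nonneg (Nat.cast_nonneg _) (hF.nonneg _)
  · exact mul_le_mul_of_nonneg_left (rpow_matExp_le_map_matMulTensor hF hm) (Nat.cast_nonneg _)

/-- **CAPACITY OF THE LASER CLASS AT A SPECTRAL POINT.**  If a laser datum of extent `N`
restricts to the packing `⟨B⟩ ⊗ ⟨m,m,m⟩`, then for every universal spectral point `F`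
`B · m^{τ_F} ≤ (N+1)³ · 3^N · 2^{((τ_F − 2)/3)·N}`. -/
theorem laserClassCapacity_point (hF : IsUniversalSpectralPoint ℂ F) {N p : ℕ}
    {x y z : Fin p → ℕ} {B m : ℕ} (hsum : ∀ i, x i + y i + z i = N)
    (hcap : ∀ t : ℕ × ℕ × ℕ, (univ.filter (fun j => (x j, y j, z j) = t)).card ≤
      N.choose (min t.1 (min t.2.1 t.2.2)))
    (hD : TensorRestrictsTo (matMulDirectSum ℂ (fun i => 2 ^ x i) (fun i => 2 ^ y i) (fun i => 2 ^ z i))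
      (kroneckerTensor (unitTensor ℂ B) (matMulTensor ℂ m m m))) :
    (B : ℝ) * (m : ℝ) ^ Real.logb 2 (F (matMulTensor ℂ 2 2 2)) ≤
      ((N : ℝ) + 1) ^ 3 * (3 : ℝ) ^ N *
        (2 : ℝ) ^ ((Real.logb 2 (F (matMulTensor ℂ 2 2 2)) - 2) / 3 * N) :=
  (mul_rpow_matExp_le hF B m).trans ((hF.mono _ _ hD).trans (map_laserDatum_le hF hsum hcap))

/-- The same for a bare product `⟨m,m,m⟩` (`B = 1`): `m^{τ_F} ≤ (N+1)³ · 3^N · 2^{((τ_F−2)/3)N}`. -/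
theorem laserClassCapacity_point_one (hF : IsUniversalSpectralPoint ℂ F) {N p : ℕ}
    {x y z : Fin p → ℕ} {m : ℕ} (hsum : ∀ i, x i + y i + z i = N)
    (hcap : ∀ t : ℕ × ℕ × ℕ, (univ.filter (fun j => (x j, y j, z j) = t)).card ≤
      N.choose (min t.1 (min t.2.1 t.2.2)))
    (hD : TensorRestrictsTo (matMulDirectSum ℂ (fun i => 2 ^ x i) (fun i => 2 ^ y i) (fun i => 2 ^ z i))
      (matMulTensor ℂ m m m)) :
    (m : ℝ) ^ Real.logb 2 (F (matMulTensor ℂ 2 2 2)) ≤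
      ((N : ℝ) + 1) ^ 3 * (3 : ℝ) ^ N *
        (2 : ℝ) ^ ((Real.logb 2 (F (matMulTensor ℂ 2 2 2)) - 2) / 3 * N) := by
  rcases Nat.eq_zero_or_pos m with rfl | hm
  · have hτ : Real.logb 2 (F (matMulTensor ℂ 2 2 2)) ≠ 0 :=
      (lt_of_lt_of_le two_pos (two_le_matExp hF)).ne'
    rw [Nat.cast_zero, Real.zero_rpow hτ]
    positivity
  · exact (rpow_matExp_le_map_matMulTensor hF hm).trans
      ((hF.mono _ _ hD).trans (map_laserDatum_le hF hsum hcap))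

/-- **CAPACITY OF THE LASER CLASS (at `ω`)** — the route item `LaserClassCapacity`:
`B · m^ω ≤ (N+1)³ · 3^N · 2^{((ω−2)/3)·N}` for every packing `⟨B⟩ ⊗ ⟨m,m,m⟩` through a laser
datum of extent `N` (evaluate at a TOP spectral point, `τ_G = ω`). -/
theorem laserClassCapacity : ∀ (N p : ℕ) (x y z : Fin p → ℕ) (B m : ℕ),
    (∀ i, x i + y i + z i = N) →
    (∀ t : ℕ × ℕ × ℕ, (Finset.univ.filter (fun j => (x j, y j, z j) = t)).card ≤
      N.choose (min t.1 (min t.2.1 t.2.2))) →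
    TensorRestrictsTo (matMulDirectSum ℂ (fun i => 2 ^ x i) (fun i => 2 ^ y i) (fun i => 2 ^ z i))
      (kroneckerTensor (unitTensor ℂ B) (matMulTensor ℂ m m m)) →
    (B : ℝ) * (m : ℝ) ^ omega ℂ ≤
      ((N : ℝ) + 1) ^ 3 * (3 : ℝ) ^ N * (2 : ℝ) ^ ((omega ℂ - 2) / 3 * N) := by
  intro N p x y z B m hsum hcap hD
  obtain ⟨G, hG, hτ⟩ := exists_top_point
  have h := laserClassCapacity_point hG hsum hcap hD
  rwa [hτ] at h

/-- The route item `LaserClassCapacity` (stmt-MatrixMultiplication-33773) holds. -/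
theorem laserClassCapacity_holds :
    Summit.MatrixMultiplication.MatrixMultiplication.Theses.OutsiderSandwich.LaserClassCapacity :=
  laserClassCapacity

end Summit.MatrixMultiplication.MatrixMultiplication.Theorems.OutsiderSandwichLaserClass
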